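import Summits.NavierStokesRegularity.NavierStokesRegularity.Theses.RecurrentProfiles
import Summits.NavierStokesRegularity.NavierStokesRegularity.Theses.SqueezeCycle
import Summits.NavierStokesRegularity.NavierStokesRegularity.Theorems.RecurrentProfilesRecurrentReductionOrbit
import Summits.NavierStokesRegularity.NavierStokesRegularity.Theorems.RecurrentProfilesRecurrentRegularIsTrivial
import Summits.NavierStokesRegularity.NavierStokesRegularity.Theorems.SqueezeCycleRecurrentLiouvilleGkWindowIncrementRemoval
import Summits.NavierStokesRegularity.NavierStokesRegularity.Theorems.SqueezeCycleRecurrentLiouvilleGkIncrementTools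
import Literature.Analysis.FluidPDE.ScalingUniformRecurrence
import HarnessLib

/-!
# Crux `RecurrentLiouville` (stmt-NavierStokesRegularity-1589), line `Sketch` (v6, Giga–Kohn harvest) —
# the typed certificate: the bet `RecurrentRests` is EQUIVALENT to the crux

Theorems-only file (no definitions, no named facts).  The line's skeleton composes the crux from
the landed window-increment-removal theorem S1 (`stub_gkWindowIncrementRemoval`) and the bet B
(`stub_gkRecurrentRests`: every uniformly recurrent member of the class has a scale at which its
scaling-orbit increments on `(−2,−1) × B_R` are `≤ δ` for all factors `1 ≤ c ≤ √2`).  This file is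
the kernel-checked certificate that B is the crux in costume (strategist census §3 S3(b), the
compactness exchange; Disproof §E1 shape):

* `recurrentLiouville_of_recurrentRests` — B ⇒ crux (zoom to the slow scale, S1, zoom back);
* `recurrentRests_of_recurrentLiouville` — crux ⇒ B (a recurrent class member is then regular,
  hence `0` a.e. on the slab by `recurrentRegularIsTrivial_proof`, item 1593, and a null field has
  null increments: a.e.-congruence `stub_gkIncrementTools.2`);
* `recurrentRests_iff_recurrentLiouville` — B ⟺ crux (both route copies).

So line Sketch v6 is COMPLETE modulo the crux itself; its content is the harvest (S1 and
`gk_stationaryWindowRemoval` / `gk_neverRests` / `gk_orbitNeverRests`).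

## References

* D. Albritton, T. Barker, J. Math. Fluid Mech. 21 (2019), Prop. 2.3, §3. [AlbrittonBarker2019]
* H. Furstenberg, *Recurrence in Ergodic Theory and Combinatorial Number Theory* (1981), Thm 1.17.
  [Furstenberg1981]
-/

noncomputable section

-- the sub-problem namespace repeats the summit name (D-0017 layout `Summit.<S>.<P>.Theorems`)
set_option linter.dupNamespace false

namespace Summit.NavierStokesRegularity.NavierStokesRegularity.Theorems

open MeasureTheory Set Function Filter Topology TopologicalSpace Metric
open Literature.Analysis Literature.Analysis.FluidPDE
open scoped NNReal ENNReal

/-- **The bet implies the crux** (the skeleton's composition, with S1 landed): zoom the recurrent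
class member to the slow scale supplied by the bet (the class, `𝐈` and the rate are scale
invariant), remove the origin singularity of the zoomed field by `stub_gkWindowIncrementRemoval`,
and zoom back. [cite: AlbrittonBarker2019, §3] -/
theorem recurrentLiouville_of_recurrentRests
    (hB : ∀ (C : ℝ) (M : ℝ≥0∞), M < ⊤ → ∀ (R δ : ℝ), 0 < R → 0 < δ →
      ∀ (u : ℝ → EuclideanSpace ℝ (Fin 3) → EuclideanSpace ℝ (Fin 3))
        (p : ℝ → EuclideanSpace ℝ (Fin 3) → ℝ)
        (G : ℝ → EuclideanSpace ℝ (Fin 3) → EuclideanSpace ℝ (Fin 3) →L[ℝ] EuclideanSpace ℝ (Fin 3)),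
        IsSuitableWeakSolutionOn (slab (EuclideanSpace ℝ (Fin 3)) (Iio 0) isOpen_Iio) 1 0 u p →
        HasWeakSpatialGradientOn (slab (EuclideanSpace ℝ (Fin 3)) (Iio 0) isOpen_Iio) u G →
        typeIBound (Iio (0 : ℝ) ×ˢ univ) u p G ≤ M →
        HasTypeITimeDecay C u →
        (∀ ε : ℝ, 0 < ε → ∀ K : Set (ℝ × EuclideanSpace ℝ (Fin 3)), IsCompact K →
          K ⊆ Set.Iic (0 : ℝ) ×ˢ Set.univ → ∃ L : ℝ, 0 < L ∧ ∀ a : ℝ, ∃ σ ∈ Set.Icc a (a + L),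
            eLpNorm (fun z : ℝ × EuclideanSpace ℝ (Fin 3) =>
              nsRescale (Real.exp σ) u z.1 z.2 - u z.1 z.2) 3 (volume.restrict K) ≤
                ENNReal.ofReal ε) →
        ∃ lam : ℝ, 0 < lam ∧ ∀ c : ℝ, 1 ≤ c → c ^ 2 ≤ 2 →
          ∫⁻ z in Ioo (-2 : ℝ) (-1) ×ˢ Metric.ball (0 : EuclideanSpace ℝ (Fin 3)) R,
            ‖nsRescale c (nsRescale lam u) z.1 z.2 - nsRescale lam u z.1 z.2‖ₑ ^ 2 ≤
              ENNReal.ofReal δ) :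
    Theses.RecurrentProfiles.RecurrentLiouville := by
  intro u p G C hsw hwg hI hdec hrec hsing
  obtain ⟨R, hR, δ, hδ, hrem⟩ :=
    stub_gkWindowIncrementRemoval C (typeIBound (Iio (0 : ℝ) ×ˢ univ) u p G) hI
  obtain ⟨lam, hlam, hsmall⟩ := hB C _ hI R δ hR hδ u p G hsw hwg le_rfl hdec hrec
  have hz := zoom_slabProfile hsw hwg hlam
  have hdec' : HasTypeITimeDecay C (nsRescale lam u) := hdec.nsRescale hlam
  refine hrem (nsRescale lam u)
    (lam ^ 2 • stPull (lam ^ 2) lam (0 : ℝ) (0 : EuclideanSpace ℝ (Fin 3)) p)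
    (lam ^ 2 • stPull (lam ^ 2) lam (0 : ℝ) (0 : EuclideanSpace ℝ (Fin 3)) G) ?_ ?_ ?_ hdec'
    hsmall ?_
  · rw [nsRescale_eq_zoom]; exact hz.1
  · rw [nsRescale_eq_zoom]; exact hz.2.1
  · rw [nsRescale_eq_zoom, hz.2.2]
  · rw [nsRescale_eq_zoom]; exact isBackwardSingularPoint_zoom hsing hlam

/-- **The crux implies the bet**: under the crux a uniformly recurrent class member is regular at
the origin, hence `0` a.e. on the slab (`recurrentRegularIsTrivial_proof`, item 1593), and a field
that vanishes a.e. has vanishing orbit increments (a.e.-congruence of the increment functional,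
`stub_gkIncrementTools.2`) — already at the scale `λ = 1`. [cite: AlbrittonBarker2019, Prop. 2.3] -/
theorem recurrentRests_of_recurrentLiouville (hL : Theses.RecurrentProfiles.RecurrentLiouville) :
    ∀ (C : ℝ) (M : ℝ≥0∞), M < ⊤ → ∀ (R δ : ℝ), 0 < R → 0 < δ →
      ∀ (u : ℝ → EuclideanSpace ℝ (Fin 3) → EuclideanSpace ℝ (Fin 3))
        (p : ℝ → EuclideanSpace ℝ (Fin 3) → ℝ)
        (G : ℝ → EuclideanSpace ℝ (Fin 3) → EuclideanSpace ℝ (Fin 3) →L[ℝ] EuclideanSpace ℝ (Fin 3)),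
        IsSuitableWeakSolutionOn (slab (EuclideanSpace ℝ (Fin 3)) (Iio 0) isOpen_Iio) 1 0 u p →
        HasWeakSpatialGradientOn (slab (EuclideanSpace ℝ (Fin 3)) (Iio 0) isOpen_Iio) u G →
        typeIBound (Iio (0 : ℝ) ×ˢ univ) u p G ≤ M →
        HasTypeITimeDecay C u →
        (∀ ε : ℝ, 0 < ε → ∀ K : Set (ℝ × EuclideanSpace ℝ (Fin 3)), IsCompact K →
          K ⊆ Set.Iic (0 : ℝ) ×ˢ Set.univ → ∃ L : ℝ, 0 < L ∧ ∀ a : ℝ, ∃ σ ∈ Set.Icc a (a + L),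
            eLpNorm (fun z : ℝ × EuclideanSpace ℝ (Fin 3) =>
              nsRescale (Real.exp σ) u z.1 z.2 - u z.1 z.2) 3 (volume.restrict K) ≤
                ENNReal.ofReal ε) →
        ∃ lam : ℝ, 0 < lam ∧ ∀ c : ℝ, 1 ≤ c → c ^ 2 ≤ 2 →
          ∫⁻ z in Ioo (-2 : ℝ) (-1) ×ˢ Metric.ball (0 : EuclideanSpace ℝ (Fin 3)) R,
            ‖nsRescale c (nsRescale lam u) z.1 z.2 - nsRescale lam u z.1 z.2‖ₑ ^ 2 ≤
              ENNReal.ofReal δ := by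
  intro C M hM R δ _ _ u p G hsw hwg hI hdec hrec
  -- the crux makes `u` regular at the origin, hence `0` a.e. on the slab (item 1593)
  have hreg : ¬ IsBackwardSingularPoint u 0 := hL u p G C hsw hwg (lt_of_le_of_lt hI hM) hdec hrec
  have hae : uncurry u =ᵐ[volume.restrict (Iio (0 : ℝ) ×ˢ univ)] 0 :=
    recurrentRegularIsTrivial_proof u hwg.locallyIntegrableOn hrec hreg
  refine ⟨1, one_pos, fun c hc1 _ => ?_⟩
  have hc0 : 0 < c := lt_of_lt_of_le one_pos hc1
  rw [nsRescale_one]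
  -- a null field has null increments
  have hae' : ∀ᵐ z ∂(volume.restrict (Iio (0 : ℝ) ×ˢ (univ : Set (EuclideanSpace ℝ (Fin 3))))),
      uncurry u z = uncurry (0 : ℝ → EuclideanSpace ℝ (Fin 3) → EuclideanSpace ℝ (Fin 3)) z := by
    filter_upwards [hae] with z hz
    exact hz
  rw [stub_gkIncrementTools.2 u 0 c R hc0 hae']
  simp

/-- **The bet is the crux** (typed certificate): the line's single open stub `stub_gkRecurrentRests`
is EQUIVALENT to `RecurrentLiouville` (⇒ by the landed window increment removal, ⇐ by vacuity
through `recurrentRegularIsTrivial_proof`).  Hence line Sketch v6 is complete modulo the crux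
itself; its content is the landed harvest. -/
theorem recurrentRests_iff_recurrentLiouville :
    (∀ (C : ℝ) (M : ℝ≥0∞), M < ⊤ → ∀ (R δ : ℝ), 0 < R → 0 < δ →
      ∀ (u : ℝ → EuclideanSpace ℝ (Fin 3) → EuclideanSpace ℝ (Fin 3))
        (p : ℝ → EuclideanSpace ℝ (Fin 3) → ℝ)
        (G : ℝ → EuclideanSpace ℝ (Fin 3) → EuclideanSpace ℝ (Fin 3) →L[ℝ] EuclideanSpace ℝ (Fin 3)),
        IsSuitableWeakSolutionOn (slab (EuclideanSpace ℝ (Fin 3)) (Iio 0) isOpen_Iio) 1 0 u p →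
        HasWeakSpatialGradientOn (slab (EuclideanSpace ℝ (Fin 3)) (Iio 0) isOpen_Iio) u G →
        typeIBound (Iio (0 : ℝ) ×ˢ univ) u p G ≤ M →
        HasTypeITimeDecay C u →
        (∀ ε : ℝ, 0 < ε → ∀ K : Set (ℝ × EuclideanSpace ℝ (Fin 3)), IsCompact K →
          K ⊆ Set.Iic (0 : ℝ) ×ˢ Set.univ → ∃ L : ℝ, 0 < L ∧ ∀ a : ℝ, ∃ σ ∈ Set.Icc a (a + L),
            eLpNorm (fun z : ℝ × EuclideanSpace ℝ (Fin 3) =>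
              nsRescale (Real.exp σ) u z.1 z.2 - u z.1 z.2) 3 (volume.restrict K) ≤
                ENNReal.ofReal ε) →
        ∃ lam : ℝ, 0 < lam ∧ ∀ c : ℝ, 1 ≤ c → c ^ 2 ≤ 2 →
          ∫⁻ z in Ioo (-2 : ℝ) (-1) ×ˢ Metric.ball (0 : EuclideanSpace ℝ (Fin 3)) R,
            ‖nsRescale c (nsRescale lam u) z.1 z.2 - nsRescale lam u z.1 z.2‖ₑ ^ 2 ≤
              ENNReal.ofReal δ) ↔
    Theses.RecurrentProfiles.RecurrentLiouville :=
  ⟨recurrentLiouville_of_recurrentRests, recurrentRests_of_recurrentLiouville⟩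

/-- The same certificate against the SqueezeCycle copy of the crux (the two route copies agree
letter for letter, `Iff.rfl`). -/
theorem recurrentRests_iff_recurrentLiouville' :
    (∀ (C : ℝ) (M : ℝ≥0∞), M < ⊤ → ∀ (R δ : ℝ), 0 < R → 0 < δ →
      ∀ (u : ℝ → EuclideanSpace ℝ (Fin 3) → EuclideanSpace ℝ (Fin 3))
        (p : ℝ → EuclideanSpace ℝ (Fin 3) → ℝ)
        (G : ℝ → EuclideanSpace ℝ (Fin 3) → EuclideanSpace ℝ (Fin 3) →L[ℝ] EuclideanSpace ℝ (Fin 3)),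
        IsSuitableWeakSolutionOn (slab (EuclideanSpace ℝ (Fin 3)) (Iio 0) isOpen_Iio) 1 0 u p →
        HasWeakSpatialGradientOn (slab (EuclideanSpace ℝ (Fin 3)) (Iio 0) isOpen_Iio) u G →
        typeIBound (Iio (0 : ℝ) ×ˢ univ) u p G ≤ M →
        HasTypeITimeDecay C u →
        (∀ ε : ℝ, 0 < ε → ∀ K : Set (ℝ × EuclideanSpace ℝ (Fin 3)), IsCompact K →
          K ⊆ Set.Iic (0 : ℝ) ×ˢ Set.univ → ∃ L : ℝ, 0 < L ∧ ∀ a : ℝ, ∃ σ ∈ Set.Icc a (a + L),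
            eLpNorm (fun z : ℝ × EuclideanSpace ℝ (Fin 3) =>
              nsRescale (Real.exp σ) u z.1 z.2 - u z.1 z.2) 3 (volume.restrict K) ≤
                ENNReal.ofReal ε) →
        ∃ lam : ℝ, 0 < lam ∧ ∀ c : ℝ, 1 ≤ c → c ^ 2 ≤ 2 →
          ∫⁻ z in Ioo (-2 : ℝ) (-1) ×ˢ Metric.ball (0 : EuclideanSpace ℝ (Fin 3)) R,
            ‖nsRescale c (nsRescale lam u) z.1 z.2 - nsRescale lam u z.1 z.2‖ₑ ^ 2 ≤
              ENNReal.ofReal δ) ↔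
    Theses.SqueezeCycle.RecurrentLiouville :=
  recurrentRests_iff_recurrentLiouville

/-- **Registered certificate stub** `stub_gkBetIffCrux` (crux stmt-NavierStokesRegularity-1589, line
Sketch v6): the bet `stub_gkRecurrentRests` ⟺ the crux (fully qualified SqueezeCycle copy). -/
theorem stub_gkBetIffCrux :
    (∀ (C : ℝ) (M : ℝ≥0∞), M < ⊤ → ∀ (R δ : ℝ), 0 < R → 0 < δ →
      ∀ (u : ℝ → EuclideanSpace ℝ (Fin 3) → EuclideanSpace ℝ (Fin 3))
        (p : ℝ → EuclideanSpace ℝ (Fin 3) → ℝ)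
        (G : ℝ → EuclideanSpace ℝ (Fin 3) → EuclideanSpace ℝ (Fin 3) →L[ℝ] EuclideanSpace ℝ (Fin 3)),
        IsSuitableWeakSolutionOn (slab (EuclideanSpace ℝ (Fin 3)) (Iio 0) isOpen_Iio) 1 0 u p →
        HasWeakSpatialGradientOn (slab (EuclideanSpace ℝ (Fin 3)) (Iio 0) isOpen_Iio) u G →
        typeIBound (Iio (0 : ℝ) ×ˢ univ) u p G ≤ M →
        HasTypeITimeDecay C u →
        (∀ ε : ℝ, 0 < ε → ∀ K : Set (ℝ × EuclideanSpace ℝ (Fin 3)), IsCompact K →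
          K ⊆ Set.Iic (0 : ℝ) ×ˢ Set.univ → ∃ L : ℝ, 0 < L ∧ ∀ a : ℝ, ∃ σ ∈ Set.Icc a (a + L),
            eLpNorm (fun z : ℝ × EuclideanSpace ℝ (Fin 3) =>
              nsRescale (Real.exp σ) u z.1 z.2 - u z.1 z.2) 3 (volume.restrict K) ≤
                ENNReal.ofReal ε) →
        ∃ lam : ℝ, 0 < lam ∧ ∀ c : ℝ, 1 ≤ c → c ^ 2 ≤ 2 →
          ∫⁻ z in Ioo (-2 : ℝ) (-1) ×ˢ Metric.ball (0 : EuclideanSpace ℝ (Fin 3)) R,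
            ‖nsRescale c (nsRescale lam u) z.1 z.2 - nsRescale lam u z.1 z.2‖ₑ ^ 2 ≤
              ENNReal.ofReal δ) ↔
    Summit.NavierStokesRegularity.NavierStokesRegularity.Theses.SqueezeCycle.RecurrentLiouville :=
  recurrentRests_iff_recurrentLiouville

end Summit.NavierStokesRegularity.NavierStokesRegularity.Theorems

end
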